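import Summits.QuantumFields.YangMills.Theses.SmallCircleAnchor
import Summits.QuantumFields.YangMills.Theorems.SmallCircleAnchorAdiabaticContinuitySplit

/-!
# Skeleton (BC3, RESHAPE r2: legs LANDED AS NAMED STATEMENTS) for the crux `AdiabaticContinuity` — stmt-QuantumFields-11142

Route `SmallCircleAnchor` (route-QuantumFields-SmallCircleAnchor, rank 3; sub-problem `YangMills`).
Line `registered` (= planner file `Lines/birth.lean`, planner-skel-stmt-QuantumFields-11142-0, 2026-08-17);
reshape r1 by lead prover-line-stmt-QuantumFields-11142-0 (corner folded into Leg A, corner LANDED p147338);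
reshape r2 by continuation lead prover-line-stmt-QuantumFields-11142-c2-0 (2026-08-17): the two open stub
STATEMENTS and the composition are now TREE DECLARATIONS —
`Theorems/SmallCircleAnchorAdiabaticContinuitySplit.lean` (p153847, accepted 2026-08-17, commit d436488cfa2b):

* `Summit.QuantumFields.YangMills.Theorems.SmallCircleAnchor.AdiabaticContinuityLegA` — verbatim the r1 stub
  statement `ThermalContinuationUniform` (A*: anchor at extent `T` ⟹ Leg A for EVERY `T' ≥ T` with ONE rate and
  `T'`-UNIFORM constants; Ünsal–Yaffe circle-size continuity incl. its zero-temperature end). OPEN PROBLEM.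
* `Summit.QuantumFields.YangMills.Theorems.SmallCircleAnchor.AdiabaticContinuityLegB` — verbatim the r1 stub
  statement `DeformationRemoval` (R: fully deformed symmetric torus clusters ⟹ every `s ∈ [0, E β]` clusters; its
  `s = 0` end is the undeformed Wilson torus, i.e. `UniformLatticeGap(r)` via the proved `EndpointTransfer`).
  OPEN PROBLEM (⊇ weak-coupling 4-D lattice mass gap).
* `Summit.QuantumFields.YangMills.Theorems.SmallCircleAnchor.AdiabaticContinuity_of_subs :
  AdiabaticContinuityLegA → AdiabaticContinuityLegB → AdiabaticContinuity` — the r1 composition, LANDED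
  (anchor → A* → landed corner `stub_decompactificationUniform` → R; thresholds by `max`, one rate by `min` via
  the rate-monotonicity of the crux's `Cl`).

So the skeleton is now two `sorry`s and one line, and a stub file proves `theorem stub_thermalContinuationUniform :
Summit.QuantumFields.YangMills.Theorems.SmallCircleAnchor.AdiabaticContinuityLegA` (resp. `stub_deformationRemoval :
Summit.QuantumFields.YangMills.Theorems.SmallCircleAnchor.AdiabaticContinuityLegB`; signatures registered FULLY QUALIFIED)
after `import Summits.QuantumFields.YangMills.Theorems.SmallCircleAnchorAdiabaticContinuitySplit` — no verbatim restatement needed.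
The same landed names serve a D-0019 typed split of the crux
(`route edit --split AdiabaticContinuity --into AdiabaticContinuityLegA AdiabaticContinuityLegB --glue AdiabaticContinuity_of_subs`),
recommended by three consecutive line leads (c0, c1, c2): both legs are INDEPENDENT open problems — c2's
reducibility tests `AnchorGap → UniformLatticeGap → LegA/LegB` do not close (crux dir `Lines/BirthReduceA.lean`,
`Lines/BirthReduceR.lean`, report `Lines/BirthWorkerAc2.md`), so neither is `blocked-on` an existing item.

Lead audit (farm `lean check --json`, 2026-08-17): rc 0, errors [], sorries 2 — exactly the two stubs;
`--axioms AdiabaticContinuity_of` = [propext, Classical.choice, Quot.sound] (plus `sorryAx` through the stubs only).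
History: r0 corner `Decompactification` superseded (shape-insufficient), r1 = r2 mathematically (r2 only names).
-/

namespace Summit.QuantumFields.YangMills.Cruxes.AdiabaticContinuity.Birth

/-! ## The two registered stubs (r2) — the ONLY `sorry`s of this file -/

/-- Registered stub A\* (r2): Leg A with `T'`-uniform constants, as the landed statement
`AdiabaticContinuityLegA`. OPEN (research-level; four worker waves `stub-blocked: none`). -/
theorem stub_thermalContinuationUniform :
    Summit.QuantumFields.YangMills.Theorems.SmallCircleAnchor.AdiabaticContinuityLegA := by
  sorry

/-- Registered stub R (r2): Leg B, deformation removal on the symmetric torus, as the landed statement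
`AdiabaticContinuityLegB`. OPEN (research-level; ⊇ the weak-coupling lattice mass gap at `s = 0`). -/
theorem stub_deformationRemoval :
    Summit.QuantumFields.YangMills.Theorems.SmallCircleAnchor.AdiabaticContinuityLegB := by
  sorry

/-! ## Name-keyed aliases of the stub statements — the hypotheses of `AdiabaticContinuity_of` -/
namespace __Registered

/-- Alias of `AdiabaticContinuityLegA` keyed by the registered stub name. -/
abbrev stub_thermalContinuationUniform : Prop :=
  Summit.QuantumFields.YangMills.Theorems.SmallCircleAnchor.AdiabaticContinuityLegA
/-- Alias of `AdiabaticContinuityLegB` keyed by the registered stub name. -/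
abbrev stub_deformationRemoval : Prop :=
  Summit.QuantumFields.YangMills.Theorems.SmallCircleAnchor.AdiabaticContinuityLegB

end __Registered

/-! ## Composition: the crux BY NAME from the two stub statements (no `sorry` below) -/

/-- **AdiabaticContinuity_of** (r2) — the landed glue `AdiabaticContinuity_of_subs` applied to the two stub
statements; conclusion = the route decl `Summit.QuantumFields.YangMills.Theses.SmallCircleAnchor.AdiabaticContinuity`, by name. -/
theorem AdiabaticContinuity_of (hA : __Registered.stub_thermalContinuationUniform)
    (hR : __Registered.stub_deformationRemoval) :
    Summit.QuantumFields.YangMills.Theses.SmallCircleAnchor.AdiabaticContinuity :=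
  Summit.QuantumFields.YangMills.Theorems.SmallCircleAnchor.AdiabaticContinuity_of_subs hA hR

end Summit.QuantumFields.YangMills.Cruxes.AdiabaticContinuity.Birth
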